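import Summits.QuantumFields.BalabanUV.Beta.SpineRecursiveT2AllSockets
import Summits.QuantumFields.BalabanUV.Beta.GAN24.CombQuarticTableLawTwinsB
import Summits.QuantumFields.BalabanUV.Beta.SpineRecursiveT2AllSocketsSU
import Summits.QuantumFields.BalabanUV.Beta.SecondOrderLetterLevels

-- `BalabanUV.Beta.GAN24.CombQuarticTableLawTwinsC`: W-an2-1 twin chain, links CombQuarticTableLawSockets, CombQuarticTableLawSocketsSU, CombQuarticTableLawLetterLevels (one module per ≤ 400-line group; each link keeps its own module docstring, section and namespace).

/-!
# `BalabanUV.Beta.GAN24.CombQuarticTableLawSockets` — binder row G-an2-4 ∕ (CONV-C), W-slot, row (C) at levels ≥ 1, WANTED W-an2-1 (the quartic TABLE-level reflection law of the comb tower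
# at the literal), FIFTH TWIN OF an2's END CHAIN: **THE QUARTIC TABLE LAW FOR THE WILSON TABLE `(8N²)⁻¹ • wsym22 N` AND an1's MIXED TABLE `mixFFAt ρ_c Lc`, (hWff) DISCHARGED** — an2's `SpineRecursiveT2AllSockets.…_of_an1_letters` VERBATIM (an3's `wilsonW₂_bref_ff_canon_bhKAt` at a complete trace-orthonormal colour basis, `RW := 0`; an1's `hmix_an1`∕`hmixt_an1`) over MY `CombQuarticTableLawAntiTwin.T2RecAt_bref_all_of_letters_antiTwin` instead of the kernel END
# (road-P2 chair of row G-an2-4, unit `b2b-balaban-gan24-p2` gen 48, crux team (2))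

NOT IN PRINT; OUR BOOKKEEPING ([folklore] wiring BY NAME; twin of an2's END with the root call swapped and the kernel-only binders dropped; 0 `def`, 0 cited facts, 0 `def … : Prop`,
0 sorry).  HONEST FRAMING (cell contract, verbatim): «discharging `BetaPertH` makes Bałaban's UV stability UNCONDITIONAL — a real constructive-QFT result; it is NOT the continuum
limit and NOT the Clay problem.»  HONEST DEPENDENCY (verbatim): «continuum YM on T⁴ ⇐ BetaPertH ∧ nine spine estimates (0/9 proved); BetaPertH ⇐ (D1) ∧ (D4) ∧ CAP+tail; G-an2-4
gates asym, D1 and NE2/3/4.»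

WHAT.  **`T2RecAt_bref_all_of_an1_letters`** (colour basis `τ : C → Matrix (Fin N) (Fin N) ℂ` complete + trace-orthonormal, `N ≠ 0`): the `∃ R2`-form quartic table law for `T := (8N²)⁻¹ • wsym22 N`, `mixFF := mixFFAt ρ_c Lc` from (hM2)+`RM`-classes, (hBat)(hBmm0)(hBe), (hlock2), (hB)(hB0).
EVERY LETTER NOT YET DISCHARGED IS A HYPOTHESIS; discharges NOTHING of (C)_{≥1} ∕ (Q-L) ∕ (H1♮); (β) of record untouched; NEVER «G-an2-4 closed» as (CONV-C); NOT D1, NOT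
`BetaPertH`, NOT continuum, NOT Clay.  2026-08-23; no existing file touched.
-/

noncomputable section

open Finset
open scoped BigOperators
open Literature.MathematicalPhysics.QuantumFieldTheory
open Literature.MathematicalPhysics.QuantumFieldTheory.Balaban1983to89
open Literature.MathematicalPhysics.QuantumFieldTheory.Balaban1983to89.Beta
open ExpKernelCalculus (MKer Decays BiLoc comp tadpole VertexFamily VertexFamily₂ shiftK)
open AffineAveraging (box toSite)
open AveragingContoursRooted (ctr ctrOff ctrOff_mem_box)
open AveragingMixedJetTables (mixFFAt)
open PolarizationSign (reflSign AxisReflectionCovariant)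
open KernelReflection (refK refK_apply)
open ResolventReflection (bref Φ)
open OneStepResolventKernel (Fib LocStencil JetData wsum)
open OneStepKernelFamily (KInvStep colH vertexOfK TbalOf flipK)
open ColourTrace (Complete TrOrthonormal pauli pauli_complete pauli_trOrthonormal)
open WilsonVertex2Sym (wsym22)
open StepJetData (wilsonA)
open WilsonBiStencil (wilsonW₂)
open HessKerRate (biLoc_zero)
open BalabanStepJetsSucc (wE wVH mmRead)
open BalabanCompositeJets (LocStencil₂)
open BalabanStepW2 (M2Of wV4 wB2)
open SecondOrderResponse (dM W2OfK W2SymOfK LocStencilFM vertex2OfK mixOfK K2OfK)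
open Summit.QuantumFields.BalabanUV.Beta.ChartConjugation (conjV conjW)
open Summit.QuantumFields.BalabanUV.Beta.AxialDressingRooted (coDressKBmAt)
open Summit.QuantumFields.BalabanUV.Beta.BorderedHessian (diagK ctGen bhKStepAt bhKStepAt_zero stepScale sgnK)
open Summit.QuantumFields.BalabanUV.Beta.WardLocusCubic (mmSym)
open Summit.QuantumFields.BalabanUV.Beta.SpineRecursiveParity (parityOdd_zero)
open Summit.QuantumFields.BalabanUV.Beta.WilsonReflectionContact2 (wilsonW₂_bref_ff_canon_bhKAt)
open Summit.QuantumFields.BalabanUV.Beta.MixedJetTablesPlug (hmix_an1 hmixt_an1)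


namespace Summit.QuantumFields.BalabanUV.Beta.GAN24.CombQuarticTableLawSockets

open Summit.QuantumFields.BalabanUV.Beta.TameKernelCalculus
open Summit.QuantumFields.BalabanUV.Beta.SpineRooted
open Summit.QuantumFields.BalabanUV.Beta.GAN24.CombQuarticTableLawAntiTwin (T2RecAt_bref_all_of_letters_antiTwin)

variable {Lc : ℕ} [NeZero Lc]

/-- NOT IN PRINT; OUR BOOKKEEPING (table-law twin of an2's `axisReflectionCovariant_flipK_TbalOf_JsRecWAtOf_of_an1_letters`; see the module docstring). -/
theorem T2RecAt_bref_all_of_an1_letters (hLc : Odd Lc) {N : ℕ} {C : Type*} [Fintype C] [DecidableEq C]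
    {τ : C → Matrix (Fin N) (Fin N) ℂ} (hτ : Complete τ) (ho : TrOrthonormal τ) (hN : N ≠ 0) (c : C) (cΛ cE₂ cB : ℝ)
    {vh₂S : Fin 4 → (Fin 4 → ℤ) → Fin 4 → (Fin 4 → ℤ) → MKer 4 (Fib 3)} (hB : ∃ C δ : ℝ, 0 < δ ∧ LocStencil₂ vh₂S C δ)
    (hB0 : ∀ κ u κ' u' (x z : Fin 4 → ℤ) (β β' : Fin 4), vh₂S κ u κ' u' x z (Sum.inl β) (Sum.inl β') = 0)
    (γ : ℕ → ℝ) (hγ : ∀ j, γ j = -((Lc : ℝ) ^ 8 / 2) * wVH 3 Lc j / (stepScale 3 Lc j * (Lc : ℝ) ^ 4))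
    (hlock2 : ∀ j, cE₂ * wV4 3 Lc (j + 1) * wVH 3 Lc (j + 1) = ((Lc : ℝ) ^ 4 * wE 3 Lc (j + 1)) ^ 2)
    (RM : ℕ → Fin 4 → Fin 4 → (Fin 4 → ℤ) → Fin 4 → (Fin 4 → ℤ) → MKer 4 (Fib 3))
    -- (hM2) THE MIXED LETTER ∀ j
    (hM2 : ∀ (j : ℕ) (α κ : Fin 4) (u : Fin 4 → ℤ) (ρ : Fin 4) (w : Fin 4 → ℤ),
      M2Of 3 Lc (mixFFAt (toSite (ctrOff 4 Lc)) Lc) j κ (bref α κ u) ρ (bref α ρ w) =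
        (reflSign α κ * reflSign α ρ) • refK (Φ Lc α)
          (M2Of 3 Lc (mixFFAt (toSite (ctrOff 4 Lc)) Lc) j κ u ρ w + conjV (M1At 3 Lc (toSite (ctrOff 4 Lc)) cΛ j ρ w) (diagK fun p c => γ j * ctGen 3 α Lc κ u p c) +
            RM j α κ u ρ w))
    (hRMc : ∀ (j : ℕ) (α : Fin 4), ∃ C δ : ℝ, 0 < δ ∧ LocStencilFM Lc (RM j α) C δ)
    (hRMp : ∀ (j : ℕ) (α : Fin 4) κ u ρ w, trK (RM j α κ u ρ w) = -sgnK (RM j α κ u ρ w))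
    -- THE BORDER TABLE IS ANTI-TWIN (parity-even) WITH NO mm BLOCK, AND ITS LETTER IS ONE EXACT fm-LAW ∀ j ≥ 0 (X-an2-46)
    (hBat : ∀ κ u κ' u' (x z : Fin 4 → ℤ) (β m : Fin 4), vh₂S κ u κ' u' z x (Sum.inr m) (Sum.inl β) = -vh₂S κ u κ' u' x z (Sum.inl β) (Sum.inr m))
    (hBmm0 : ∀ κ u κ' u' (x z : Fin 4 → ℤ) (m m' : Fin 4), vh₂S κ u κ' u' x z (Sum.inr m) (Sum.inr m') = 0)
    (hBe : ∀ (j : ℕ) (α : Fin 4) κ u κ' u' (x z : Fin 4 → ℤ) (β m : Fin 4),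
      ((cB * wB2 3 Lc j) • vh₂S κ (bref α κ u) κ' (bref α κ' u')) x z (Sum.inl β) (Sum.inr m) =
        ((reflSign α κ * reflSign α κ') • refK (Φ Lc α) ((cB * wB2 3 Lc j) • vh₂S κ u κ' u' +
          conjW (bhKStepAt 3 (toSite (ctrOff 4 Lc)) Lc j)
            (SpureRecAt 3 Lc (toSite (ctrOff 4 Lc)) ((Lc : ℝ) ^ 4) (-((Lc : ℝ) ^ 8 / 2)) cΛ j κ u)
            (SpureRecAt 3 Lc (toSite (ctrOff 4 Lc)) ((Lc : ℝ) ^ 4) (-((Lc : ℝ) ^ 8 / 2)) cΛ j κ' u')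
            (diagK fun p c => γ j * ctGen 3 α Lc κ u p c) (diagK fun p c => γ j * ctGen 3 α Lc κ' u' p c)
            (diagK fun p c => γ j ^ 2 * (ctGen 3 α Lc κ u p c * ctGen 3 α Lc κ' u' p c)))) x z (Sum.inl β) (Sum.inr m))
    :
    ∃ R2 : ℕ → Fin 4 → Fin 4 → (Fin 4 → ℤ) → Fin 4 → (Fin 4 → ℤ) → ExpKernelCalculus.MKer 4 (OneStepResolventKernel.Fib 3),
      (∀ (j : ℕ) (α : Fin 4), ∃ C δ : ℝ, 0 < δ ∧ BalabanCompositeJets.LocStencil₂ (R2 j α) C δ) ∧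
      (∀ (j : ℕ) (α : Fin 4) κ u κ' u', TameKernelCalculus.trK (R2 j α κ u κ' u') = -BorderedHessian.sgnK (R2 j α κ u κ' u')) ∧
      ∀ (j : ℕ) (α κ : Fin 4) (u : Fin 4 → ℤ) (κ' : Fin 4) (u' : Fin 4 → ℤ),
        SpineRooted.T2RecAt 3 Lc (AffineAveraging.toSite (AveragingContoursRooted.ctrOff 4 Lc)) ((Lc : ℝ) ^ 4) (-((Lc : ℝ) ^ 8 / 2)) cΛ cE₂ cB ((8 * (N : ℝ) ^ 2)⁻¹ • wsym22 N) vh₂S (mixFFAt (AffineAveraging.toSite (AveragingContoursRooted.ctrOff 4 Lc)) Lc) j κ (ResolventReflection.bref α κ u) κ' (ResolventReflection.bref α κ' u') =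
          (PolarizationSign.reflSign α κ * PolarizationSign.reflSign α κ') • KernelReflection.refK (ResolventReflection.Φ Lc α)
            (SpineRooted.T2RecAt 3 Lc (AffineAveraging.toSite (AveragingContoursRooted.ctrOff 4 Lc)) ((Lc : ℝ) ^ 4) (-((Lc : ℝ) ^ 8 / 2)) cΛ cE₂ cB ((8 * (N : ℝ) ^ 2)⁻¹ • wsym22 N) vh₂S (mixFFAt (AffineAveraging.toSite (AveragingContoursRooted.ctrOff 4 Lc)) Lc) j κ u κ' u' +
              ChartConjugation.conjW (BorderedHessian.bhKStepAt 3 (AffineAveraging.toSite (AveragingContoursRooted.ctrOff 4 Lc)) Lc j)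
                (SpineRooted.SpureRecAt 3 Lc (AffineAveraging.toSite (AveragingContoursRooted.ctrOff 4 Lc)) ((Lc : ℝ) ^ 4) (-((Lc : ℝ) ^ 8 / 2)) cΛ j κ u)
                (SpineRooted.SpureRecAt 3 Lc (AffineAveraging.toSite (AveragingContoursRooted.ctrOff 4 Lc)) ((Lc : ℝ) ^ 4) (-((Lc : ℝ) ^ 8 / 2)) cΛ j κ' u')
                (BorderedHessian.diagK fun p c => γ j * BorderedHessian.ctGen 3 α Lc κ u p c) (BorderedHessian.diagK fun p c => γ j * BorderedHessian.ctGen 3 α Lc κ' u' p c) (BorderedHessian.diagK fun p c => γ j ^ 2 * (BorderedHessian.ctGen 3 α Lc κ u p c * BorderedHessian.ctGen 3 α Lc κ' u' p c)) +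
              R2 j α κ u κ' u') :=
  T2RecAt_bref_all_of_letters_antiTwin hLc cΛ cE₂ cB ((8 * (N : ℝ) ^ 2)⁻¹ • wsym22 N) hB hB0
    (hmix_an1 (d := 3) hLc.pos (ctrOff_mem_box hLc.pos)) γ hγ hlock2 RM (fun _ _ _ _ _ => 0)
    (fun α κ u κ' u' x z β β' => by
      simpa only [Pi.zero_apply, add_zero, bhKStepAt_zero] using
        wilsonW₂_bref_ff_canon_bhKAt (d := 3) hτ ho hN c (toSite (ctrOff 4 Lc)) Lc Lc α κ κ' u u' x z β β')
    (fun _ _ _ _ _ _ _ _ _ => rfl) (fun _ _ _ _ _ _ _ _ _ => rfl)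
    (fun _ => ⟨0, 1, one_pos, fun κ u κ' u' => by simpa using (biLoc_zero u u (1 : ℝ) : BiLoc (0 : MKer 4 (Fib 3)) u u 0 1)⟩)
    (fun _ _ _ _ _ => parityOdd_zero) hM2 hRMc hRMp hBat hBmm0 hBe

end Summit.QuantumFields.BalabanUV.Beta.GAN24.CombQuarticTableLawSockets

end

/-!
# `BalabanUV.Beta.GAN24.CombQuarticTableLawSocketsSU` — binder row G-an2-4 ∕ (CONV-C), W-slot, row (C) at levels ≥ 1, WANTED W-an2-1 (the quartic TABLE-level reflection law of the comb tower
# at the literal), SIXTH TWIN OF an2's END CHAIN: **THE `SU(N)` INSTANCE, `N ≥ 2`** (colour basis := `ColourBasisSU.suGen N`) — an2's `SpineRecursiveT2AllSocketsSU.…_of_an1_letters_suN` VERBATIM over MY `CombQuarticTableLawSockets.T2RecAt_bref_all_of_an1_letters` instead of the kernel END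
# (road-P2 chair of row G-an2-4, unit `b2b-balaban-gan24-p2` gen 48, crux team (2))

NOT IN PRINT; OUR BOOKKEEPING ([folklore] wiring BY NAME; twin of an2's END with the root call swapped and the kernel-only binders dropped; 0 `def`, 0 cited facts, 0 `def … : Prop`,
0 sorry).  HONEST FRAMING (cell contract, verbatim): «discharging `BetaPertH` makes Bałaban's UV stability UNCONDITIONAL — a real constructive-QFT result; it is NOT the continuum
limit and NOT the Clay problem.»  HONEST DEPENDENCY (verbatim): «continuum YM on T⁴ ⇐ BetaPertH ∧ nine spine estimates (0/9 proved); BetaPertH ⇐ (D1) ∧ (D4) ∧ CAP+tail; G-an2-4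
gates asym, D1 and NE2/3/4.»

WHAT.  **`T2RecAt_bref_all_of_an1_letters_suN (hLc : Odd Lc) (hN : 2 ≤ N) …`**: the `∃ R2`-form quartic table law for `T := (8N²)⁻¹ • wsym22 N`, `mixFF := mixFFAt ρ_c Lc` from (hM2)+`RM`-classes, (hBat)(hBmm0)(hBe), (hlock2), (hB)(hB0).
EVERY LETTER NOT YET DISCHARGED IS A HYPOTHESIS; discharges NOTHING of (C)_{≥1} ∕ (Q-L) ∕ (H1♮); (β) of record untouched; NEVER «G-an2-4 closed» as (CONV-C); NOT D1, NOT
`BetaPertH`, NOT continuum, NOT Clay.  2026-08-23; no existing file touched.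
-/

noncomputable section

open Finset
open scoped BigOperators
open Literature.MathematicalPhysics.QuantumFieldTheory
open Literature.MathematicalPhysics.QuantumFieldTheory.Balaban1983to89
open Literature.MathematicalPhysics.QuantumFieldTheory.Balaban1983to89.Beta
open ExpKernelCalculus (MKer Decays BiLoc comp tadpole VertexFamily VertexFamily₂ shiftK)
open AffineAveraging (box toSite)
open AveragingContoursRooted (ctr ctrOff ctrOff_mem_box)
open AveragingMixedJetTables (mixFFAt)
open PolarizationSign (reflSign AxisReflectionCovariant)
open KernelReflection (refK refK_apply)
open ResolventReflection (bref Φ)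
open OneStepResolventKernel (Fib LocStencil JetData wsum)
open OneStepKernelFamily (KInvStep colH vertexOfK TbalOf flipK)
open WilsonVertex2Sym (wsym22)
open BalabanStepJetsSucc (wE wVH mmRead)
open BalabanCompositeJets (LocStencil₂)
open BalabanStepW2 (M2Of wV4 wB2)
open SecondOrderResponse (dM W2OfK W2SymOfK LocStencilFM vertex2OfK mixOfK K2OfK)
open Summit.QuantumFields.BalabanUV.Beta.ChartConjugation (conjV conjW)
open Summit.QuantumFields.BalabanUV.Beta.AxialDressingRooted (coDressKBmAt)
open Summit.QuantumFields.BalabanUV.Beta.BorderedHessian (diagK ctGen bhKStepAt stepScale sgnK)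
open Summit.QuantumFields.BalabanUV.Beta.MixedJetTablesPlug (hmix_an1)
open Summit.QuantumFields.BalabanUV.Beta.ColourBasisSU (suGen suGen_complete suGen_trOrthonormal diagIndex ne_zero_of_two_le)


namespace Summit.QuantumFields.BalabanUV.Beta.GAN24.CombQuarticTableLawSocketsSU

open Summit.QuantumFields.BalabanUV.Beta.TameKernelCalculus
open Summit.QuantumFields.BalabanUV.Beta.SpineRooted
open Summit.QuantumFields.BalabanUV.Beta.GAN24.CombQuarticTableLawSockets (T2RecAt_bref_all_of_an1_letters)

variable {Lc : ℕ} [NeZero Lc]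

/-- NOT IN PRINT; OUR BOOKKEEPING (table-law twin of an2's `axisReflectionCovariant_flipK_TbalOf_JsRecWAtOf_of_an1_letters_suN`; see the module docstring). -/
theorem T2RecAt_bref_all_of_an1_letters_suN (hLc : Odd Lc) {N : ℕ} (hN : 2 ≤ N) (cΛ cE₂ cB : ℝ)
    {vh₂S : Fin 4 → (Fin 4 → ℤ) → Fin 4 → (Fin 4 → ℤ) → MKer 4 (Fib 3)} (hB : ∃ C δ : ℝ, 0 < δ ∧ LocStencil₂ vh₂S C δ)
    (hB0 : ∀ κ u κ' u' (x z : Fin 4 → ℤ) (β β' : Fin 4), vh₂S κ u κ' u' x z (Sum.inl β) (Sum.inl β') = 0)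
    (γ : ℕ → ℝ) (hγ : ∀ j, γ j = -((Lc : ℝ) ^ 8 / 2) * wVH 3 Lc j / (stepScale 3 Lc j * (Lc : ℝ) ^ 4))
    (hlock2 : ∀ j, cE₂ * wV4 3 Lc (j + 1) * wVH 3 Lc (j + 1) = ((Lc : ℝ) ^ 4 * wE 3 Lc (j + 1)) ^ 2)
    (RM : ℕ → Fin 4 → Fin 4 → (Fin 4 → ℤ) → Fin 4 → (Fin 4 → ℤ) → MKer 4 (Fib 3))
    -- (hM2) THE MIXED LETTER ∀ j
    (hM2 : ∀ (j : ℕ) (α κ : Fin 4) (u : Fin 4 → ℤ) (ρ : Fin 4) (w : Fin 4 → ℤ),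
      M2Of 3 Lc (mixFFAt (toSite (ctrOff 4 Lc)) Lc) j κ (bref α κ u) ρ (bref α ρ w) =
        (reflSign α κ * reflSign α ρ) • refK (Φ Lc α)
          (M2Of 3 Lc (mixFFAt (toSite (ctrOff 4 Lc)) Lc) j κ u ρ w + conjV (M1At 3 Lc (toSite (ctrOff 4 Lc)) cΛ j ρ w) (diagK fun p c => γ j * ctGen 3 α Lc κ u p c) +
            RM j α κ u ρ w))
    (hRMc : ∀ (j : ℕ) (α : Fin 4), ∃ C δ : ℝ, 0 < δ ∧ LocStencilFM Lc (RM j α) C δ)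
    (hRMp : ∀ (j : ℕ) (α : Fin 4) κ u ρ w, trK (RM j α κ u ρ w) = -sgnK (RM j α κ u ρ w))
    -- THE BORDER TABLE IS ANTI-TWIN (parity-even) WITH NO mm BLOCK, AND ITS LETTER IS ONE EXACT fm-LAW ∀ j ≥ 0 (X-an2-46)
    (hBat : ∀ κ u κ' u' (x z : Fin 4 → ℤ) (β m : Fin 4), vh₂S κ u κ' u' z x (Sum.inr m) (Sum.inl β) = -vh₂S κ u κ' u' x z (Sum.inl β) (Sum.inr m))
    (hBmm0 : ∀ κ u κ' u' (x z : Fin 4 → ℤ) (m m' : Fin 4), vh₂S κ u κ' u' x z (Sum.inr m) (Sum.inr m') = 0)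
    (hBe : ∀ (j : ℕ) (α : Fin 4) κ u κ' u' (x z : Fin 4 → ℤ) (β m : Fin 4),
      ((cB * wB2 3 Lc j) • vh₂S κ (bref α κ u) κ' (bref α κ' u')) x z (Sum.inl β) (Sum.inr m) =
        ((reflSign α κ * reflSign α κ') • refK (Φ Lc α) ((cB * wB2 3 Lc j) • vh₂S κ u κ' u' +
          conjW (bhKStepAt 3 (toSite (ctrOff 4 Lc)) Lc j)
            (SpureRecAt 3 Lc (toSite (ctrOff 4 Lc)) ((Lc : ℝ) ^ 4) (-((Lc : ℝ) ^ 8 / 2)) cΛ j κ u)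
            (SpureRecAt 3 Lc (toSite (ctrOff 4 Lc)) ((Lc : ℝ) ^ 4) (-((Lc : ℝ) ^ 8 / 2)) cΛ j κ' u')
            (diagK fun p c => γ j * ctGen 3 α Lc κ u p c) (diagK fun p c => γ j * ctGen 3 α Lc κ' u' p c)
            (diagK fun p c => γ j ^ 2 * (ctGen 3 α Lc κ u p c * ctGen 3 α Lc κ' u' p c)))) x z (Sum.inl β) (Sum.inr m))
    :
    ∃ R2 : ℕ → Fin 4 → Fin 4 → (Fin 4 → ℤ) → Fin 4 → (Fin 4 → ℤ) → ExpKernelCalculus.MKer 4 (OneStepResolventKernel.Fib 3),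
      (∀ (j : ℕ) (α : Fin 4), ∃ C δ : ℝ, 0 < δ ∧ BalabanCompositeJets.LocStencil₂ (R2 j α) C δ) ∧
      (∀ (j : ℕ) (α : Fin 4) κ u κ' u', TameKernelCalculus.trK (R2 j α κ u κ' u') = -BorderedHessian.sgnK (R2 j α κ u κ' u')) ∧
      ∀ (j : ℕ) (α κ : Fin 4) (u : Fin 4 → ℤ) (κ' : Fin 4) (u' : Fin 4 → ℤ),
        SpineRooted.T2RecAt 3 Lc (AffineAveraging.toSite (AveragingContoursRooted.ctrOff 4 Lc)) ((Lc : ℝ) ^ 4) (-((Lc : ℝ) ^ 8 / 2)) cΛ cE₂ cB ((8 * (N : ℝ) ^ 2)⁻¹ • wsym22 N) vh₂S (mixFFAt (AffineAveraging.toSite (AveragingContoursRooted.ctrOff 4 Lc)) Lc) j κ (ResolventReflection.bref α κ u) κ' (ResolventReflection.bref α κ' u') =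
          (PolarizationSign.reflSign α κ * PolarizationSign.reflSign α κ') • KernelReflection.refK (ResolventReflection.Φ Lc α)
            (SpineRooted.T2RecAt 3 Lc (AffineAveraging.toSite (AveragingContoursRooted.ctrOff 4 Lc)) ((Lc : ℝ) ^ 4) (-((Lc : ℝ) ^ 8 / 2)) cΛ cE₂ cB ((8 * (N : ℝ) ^ 2)⁻¹ • wsym22 N) vh₂S (mixFFAt (AffineAveraging.toSite (AveragingContoursRooted.ctrOff 4 Lc)) Lc) j κ u κ' u' +
              ChartConjugation.conjW (BorderedHessian.bhKStepAt 3 (AffineAveraging.toSite (AveragingContoursRooted.ctrOff 4 Lc)) Lc j)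
                (SpineRooted.SpureRecAt 3 Lc (AffineAveraging.toSite (AveragingContoursRooted.ctrOff 4 Lc)) ((Lc : ℝ) ^ 4) (-((Lc : ℝ) ^ 8 / 2)) cΛ j κ u)
                (SpineRooted.SpureRecAt 3 Lc (AffineAveraging.toSite (AveragingContoursRooted.ctrOff 4 Lc)) ((Lc : ℝ) ^ 4) (-((Lc : ℝ) ^ 8 / 2)) cΛ j κ' u')
                (BorderedHessian.diagK fun p c => γ j * BorderedHessian.ctGen 3 α Lc κ u p c) (BorderedHessian.diagK fun p c => γ j * BorderedHessian.ctGen 3 α Lc κ' u' p c) (BorderedHessian.diagK fun p c => γ j ^ 2 * (BorderedHessian.ctGen 3 α Lc κ u p c * BorderedHessian.ctGen 3 α Lc κ' u' p c)) +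
              R2 j α κ u κ' u') :=
  T2RecAt_bref_all_of_an1_letters hLc (suGen_complete (ne_zero_of_two_le hN)) (suGen_trOrthonormal N)
    (ne_zero_of_two_le hN) (diagIndex hN) cΛ cE₂ cB hB hB0 γ hγ hlock2 RM hM2 hRMc hRMp hBat hBmm0 hBe

end Summit.QuantumFields.BalabanUV.Beta.GAN24.CombQuarticTableLawSocketsSU

end

/-!
# `BalabanUV.Beta.GAN24.CombQuarticTableLawLetterLevels` — binder row G-an2-4 ∕ (CONV-C), W-slot, row (C) at levels ≥ 1, WANTED W-an2-1 (the quartic TABLE-level reflection law of the comb tower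
# at the literal), SEVENTH TWIN OF an2's END CHAIN: **THE QUARTIC TABLE LAW ⟸ an1's TWO LETTERS AT LEVEL `0` ONLY** ((B₀) `BorderPrim`, (M₀) `MixedPrim` with a level-free odd `LocStencilFM` residual `RM₀`, lifted to every level by `border_all_of_prim` ∕ `mixed_all_of_prim`) — an2 gen 21's `SecondOrderLetterLevels.…_of_an1_letters₀_suN` VERBATIM over MY `CombQuarticTableLawSocketsSU.T2RecAt_bref_all_of_an1_letters_suN` instead of the kernel END
# (road-P2 chair of row G-an2-4, unit `b2b-balaban-gan24-p2` gen 48, crux team (2))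

NOT IN PRINT; OUR BOOKKEEPING ([folklore] wiring BY NAME; twin of an2's END with the root call swapped and the kernel-only binders dropped; 0 `def`, 0 cited facts, 0 `def … : Prop`,
0 sorry).  HONEST FRAMING (cell contract, verbatim): «discharging `BetaPertH` makes Bałaban's UV stability UNCONDITIONAL — a real constructive-QFT result; it is NOT the continuum
limit and NOT the Clay problem.»  HONEST DEPENDENCY (verbatim): «continuum YM on T⁴ ⇐ BetaPertH ∧ nine spine estimates (0/9 proved); BetaPertH ⇐ (D1) ∧ (D4) ∧ CAP+tail; G-an2-4
gates asym, D1 and NE2/3/4.»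

WHAT.  **`T2RecAt_bref_all_of_an1_letters₀_suN (hLc : Odd Lc) (hN : 2 ≤ N) …`**: the `∃ R2`-form quartic table law for `T := (8N²)⁻¹ • wsym22 N`, `mixFF := mixFFAt ρ_c Lc` from (M₀) `hM₀` + (hRM₀c)(hRM₀p), (hBat)(hBmm0), (B₀) `hB₀`, (hlock2), (hB)(hB0).
EVERY LETTER NOT YET DISCHARGED IS A HYPOTHESIS; discharges NOTHING of (C)_{≥1} ∕ (Q-L) ∕ (H1♮); (β) of record untouched; NEVER «G-an2-4 closed» as (CONV-C); NOT D1, NOT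
`BetaPertH`, NOT continuum, NOT Clay.  2026-08-23; no existing file touched.
-/

noncomputable section

open Finset
open scoped BigOperators
open Literature.MathematicalPhysics.QuantumFieldTheory
open Literature.MathematicalPhysics.QuantumFieldTheory.Balaban1983to89
open Literature.MathematicalPhysics.QuantumFieldTheory.Balaban1983to89.Beta
open ExpKernelCalculus (MKer Decays BiLoc comp tadpole VertexFamily VertexFamily₂ shiftK)
open AffineAveraging (box toSite)
open AveragingContoursRooted (ctr ctrOff ctrOff_mem_box)
open AveragingHessianKernelsRooted (vhSAt hessFFAt)
open AveragingMixedJetTables (mixFFAt)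
open PolarizationSign (reflSign AxisReflectionCovariant)
open KernelReflection (refK refK_apply)
open ResolventReflection (bref Φ)
open OneStepResolventKernel (Fib LocStencil JetData wsum)
open OneStepKernelFamily (KInvStep colH vertexOfK TbalOf flipK)
open ColourTrace (Complete TrOrthonormal)
open WilsonVertex2Sym (wsym22)
open StepJetData (wilsonA)
open B12Sec2to5 (l1 l1_nonneg)
open BalabanStepJetsSucc (wE wVH mmRead)
open BalabanCompositeJets (LocStencil₂)
open BalabanStepW2 (M2Of wV4 wB2 wM1 wM2)
open SecondOrderResponse (dM W2OfK W2SymOfK LocStencilFM vertex2OfK mixOfK K2OfK biLoc_smul)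
open Summit.QuantumFields.BalabanUV.Beta.ChartConjugation (conjV conjW)
open Summit.QuantumFields.BalabanUV.Beta.AxialDressingRooted (coDressKBmAt)
open Summit.QuantumFields.BalabanUV.Beta.BorderedHessian (diagK ctGen bhKAt bhKStepAt bhKStepAt_zero bhKStepAt_succ_fm stepScale sgnK
  conjV_diagK_apply)
open Summit.QuantumFields.BalabanUV.Beta.SpineRecursiveParity (parityOdd_smul)
open Summit.QuantumFields.BalabanUV.Beta.SecondOrderStepLaw (conjW_diag_apply)
open Summit.QuantumFields.BalabanUV.Beta.MixedJetTablesPlug (hmix_an1)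
open Summit.QuantumFields.BalabanUV.Beta.ColourBasisSU (suGen suGen_complete suGen_trOrthonormal diagIndex ne_zero_of_two_le)


namespace Summit.QuantumFields.BalabanUV.Beta.GAN24.CombQuarticTableLawLetterLevels

open Summit.QuantumFields.BalabanUV.Beta.TameKernelCalculus
open Summit.QuantumFields.BalabanUV.Beta.SpineRooted
open Summit.QuantumFields.BalabanUV.Beta.SecondOrderLetterLevels
open Summit.QuantumFields.BalabanUV.Beta.GAN24.CombQuarticTableLawSocketsSU (T2RecAt_bref_all_of_an1_letters_suN)

variable {Lc : ℕ} [NeZero Lc]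

/-- NOT IN PRINT; OUR BOOKKEEPING (table-law twin of an2's `axisReflectionCovariant_flipK_TbalOf_JsRecWAtOf_of_an1_letters₀_suN`; see the module docstring). -/
theorem T2RecAt_bref_all_of_an1_letters₀_suN (hLc : Odd Lc) {N : ℕ} (hN : 2 ≤ N) (cΛ cE₂ cB : ℝ)
    {vh₂S : Fin 4 → (Fin 4 → ℤ) → Fin 4 → (Fin 4 → ℤ) → MKer 4 (Fib 3)} (hB : ∃ C δ : ℝ, 0 < δ ∧ LocStencil₂ vh₂S C δ)
    (hB0 : ∀ κ u κ' u' (x z : Fin 4 → ℤ) (β β' : Fin 4), vh₂S κ u κ' u' x z (Sum.inl β) (Sum.inl β') = 0)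
    (γ : ℕ → ℝ) (hγ : ∀ j, γ j = -((Lc : ℝ) ^ 8 / 2) * wVH 3 Lc j / (stepScale 3 Lc j * (Lc : ℝ) ^ 4))
    (hlock2 : ∀ j, cE₂ * wV4 3 Lc (j + 1) * wVH 3 Lc (j + 1) = ((Lc : ℝ) ^ 4 * wE 3 Lc (j + 1)) ^ 2)
    (RM₀ : Fin 4 → Fin 4 → (Fin 4 → ℤ) → Fin 4 → (Fin 4 → ℤ) → MKer 4 (Fib 3))
    (hM₀ : MixedPrim Lc (toSite (ctrOff 4 Lc)) cΛ (mixFFAt (toSite (ctrOff 4 Lc)) Lc) RM₀)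
    (hRM₀c : ∀ α : Fin 4, ∃ C δ : ℝ, 0 < δ ∧ LocStencilFM Lc (RM₀ α) C δ)
    (hRM₀p : ∀ (α : Fin 4) κ u ρ w, trK (RM₀ α κ u ρ w) = -sgnK (RM₀ α κ u ρ w))
    (hBat : ∀ κ u κ' u' (x z : Fin 4 → ℤ) (β m : Fin 4), vh₂S κ u κ' u' z x (Sum.inr m) (Sum.inl β) = -vh₂S κ u κ' u' x z (Sum.inl β) (Sum.inr m))
    (hBmm0 : ∀ κ u κ' u' (x z : Fin 4 → ℤ) (m m' : Fin 4), vh₂S κ u κ' u' x z (Sum.inr m) (Sum.inr m') = 0)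
    (hB₀ : BorderPrim Lc (toSite (ctrOff 4 Lc)) cB vh₂S)
    :
    ∃ R2 : ℕ → Fin 4 → Fin 4 → (Fin 4 → ℤ) → Fin 4 → (Fin 4 → ℤ) → ExpKernelCalculus.MKer 4 (OneStepResolventKernel.Fib 3),
      (∀ (j : ℕ) (α : Fin 4), ∃ C δ : ℝ, 0 < δ ∧ BalabanCompositeJets.LocStencil₂ (R2 j α) C δ) ∧
      (∀ (j : ℕ) (α : Fin 4) κ u κ' u', TameKernelCalculus.trK (R2 j α κ u κ' u') = -BorderedHessian.sgnK (R2 j α κ u κ' u')) ∧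
      ∀ (j : ℕ) (α κ : Fin 4) (u : Fin 4 → ℤ) (κ' : Fin 4) (u' : Fin 4 → ℤ),
        SpineRooted.T2RecAt 3 Lc (AffineAveraging.toSite (AveragingContoursRooted.ctrOff 4 Lc)) ((Lc : ℝ) ^ 4) (-((Lc : ℝ) ^ 8 / 2)) cΛ cE₂ cB ((8 * (N : ℝ) ^ 2)⁻¹ • wsym22 N) vh₂S (mixFFAt (AffineAveraging.toSite (AveragingContoursRooted.ctrOff 4 Lc)) Lc) j κ (ResolventReflection.bref α κ u) κ' (ResolventReflection.bref α κ' u') =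
          (PolarizationSign.reflSign α κ * PolarizationSign.reflSign α κ') • KernelReflection.refK (ResolventReflection.Φ Lc α)
            (SpineRooted.T2RecAt 3 Lc (AffineAveraging.toSite (AveragingContoursRooted.ctrOff 4 Lc)) ((Lc : ℝ) ^ 4) (-((Lc : ℝ) ^ 8 / 2)) cΛ cE₂ cB ((8 * (N : ℝ) ^ 2)⁻¹ • wsym22 N) vh₂S (mixFFAt (AffineAveraging.toSite (AveragingContoursRooted.ctrOff 4 Lc)) Lc) j κ u κ' u' +
              ChartConjugation.conjW (BorderedHessian.bhKStepAt 3 (AffineAveraging.toSite (AveragingContoursRooted.ctrOff 4 Lc)) Lc j)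
                (SpineRooted.SpureRecAt 3 Lc (AffineAveraging.toSite (AveragingContoursRooted.ctrOff 4 Lc)) ((Lc : ℝ) ^ 4) (-((Lc : ℝ) ^ 8 / 2)) cΛ j κ u)
                (SpineRooted.SpureRecAt 3 Lc (AffineAveraging.toSite (AveragingContoursRooted.ctrOff 4 Lc)) ((Lc : ℝ) ^ 4) (-((Lc : ℝ) ^ 8 / 2)) cΛ j κ' u')
                (BorderedHessian.diagK fun p c => γ j * BorderedHessian.ctGen 3 α Lc κ u p c) (BorderedHessian.diagK fun p c => γ j * BorderedHessian.ctGen 3 α Lc κ' u' p c) (BorderedHessian.diagK fun p c => γ j ^ 2 * (BorderedHessian.ctGen 3 α Lc κ u p c * BorderedHessian.ctGen 3 α Lc κ' u' p c)) +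
              R2 j α κ u κ' u') :=
  T2RecAt_bref_all_of_an1_letters_suN hLc hN cΛ cE₂ cB hB hB0 γ hγ hlock2 (levels Lc RM₀)
    (mixed_all_of_prim (toSite (ctrOff 4 Lc)) cΛ hγ hM₀) (locStencilFM_levels hRM₀c) (parityOdd_levels hRM₀p) hBat hBmm0
    (border_all_of_prim (toSite (ctrOff 4 Lc)) cΛ cB hγ hB₀)

end Summit.QuantumFields.BalabanUV.Beta.GAN24.CombQuarticTableLawLetterLevels

end
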